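import Literature.IUT.HodgeTheaters.LabelsPlusMinus

/-!
# [IUTchI] §6, Definition 6.1 (i), continued: `𝔽_l^±`-torsors, `Aut_+(T) ⊆ Aut_±(T)`

Mochizuki, *Inter-universal Teichmüller theory I*, §6 Definition 6.1 (i), kurims manuscript (May
2020) p. 155 [cite: Mochizuki2012, IUTchI Def 6.1 (i) p.155] — second half of the item, over the
label group `𝔽_l^{⋊±} = 𝔽_l ⋊ {±1}` of `LabelsPlusMinus.lean`; every printed claim PROVED:

* an `𝔽_l^±`-torsor is "any set `T` equipped with an `𝔽_l^{⋊±}`-orbit of bijections `T ≃ 𝔽_l`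
  [relative to the action of `𝔽_l^{⋊±}` on `𝔽_l` by `z ↦ ±z + λ`]" (`FlPMTorsor l T`);
* the translations `z ↦ z + λ` determine "an abelian group `Aut_+(T)` of positive automorphisms
  of the underlying set of `T`" (`FlPMTorsor.autPlus`; chart-independent `mem_autPlus_iff_exists`;
  abelian `autPlus_comm`);
* "`Aut_+(T)` is equipped with a natural structure of `𝔽_l^±`-group [such that the abelian group
  structure of `Aut_+(T)` coincides with the `𝔽_l`-module structure of `Aut_+(T)` induced by this
  `𝔽_l^±`-group structure]" (`FlPMTorsor.autPlusPM`, `shiftChart_mul`);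
* `Aut_±(T)`, "the group of automorphisms of the underlying set of `T` determined by ... `𝔽_l^{⋊±}`"
  (`FlPMTorsor.autPM`), "[so `Aut_+(T) ⊆ Aut_±(T)` is the unique subgroup of index 2]"
  (`autPlus_le_autPM`; `relIndex_autPlus_autPM` for `2 < l`; uniqueness
  `eq_autPlus_of_relIndex_eq_two` for odd `l > 2` — for even `l` the dihedral group `𝔽_l ⋊ {±1}`
  has three index-2 subgroups, and for `l ≤ 2` the reflection is a translation, so these
  hypotheses are exactly what the printed claim needs; in IUT `l ≥ 5` is prime).
-/

namespace Literature.IUT.HodgeTheaters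

variable (l : ℕ)

/-- In `𝔽_l`, `(−1) • z = −z` for the sign `−1 ∈ {±1} = ℤˣ`. [folklore] -/
private theorem neg_one_units_smul' (z : ZMod l) : (-1 : ℤˣ) • z = -z := by
  rw [Units.smul_def, Units.val_neg, Units.val_one, neg_smul, one_smul]

/-- For `2 < l`, `1 ≠ −1` in `𝔽_l`. [folklore] -/
private theorem one_ne_neg_one' (hl : 2 < l) : (1 : ZMod l) ≠ -1 := by
  intro h
  have h2 : ((2 : ℕ) : ZMod l) = 0 := by
    rw [Nat.cast_ofNat]
    calc (2 : ZMod l) = 1 + 1 := one_add_one_eq_two.symm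
      _ = 1 + -1 := by nth_rw 2 [h]
      _ = 0 := add_neg_cancel 1
  rw [ZMod.natCast_eq_zero_iff] at h2
  exact absurd (Nat.le_of_dvd two_pos h2) (not_le.mpr hl)

/-! ### `𝔽_l^±`-torsors, `Aut_+(T)`, `Aut_±(T)` -/

/-- An **`𝔽_l^±`-torsor** structure on a set `T`: "any set `T` equipped with an `𝔽_l^{⋊±}`-orbit of
bijections `T ≃ 𝔽_l` [relative to the action of `𝔽_l^{⋊±}` on `𝔽_l` by automorphisms of the form
`𝔽_l ∋ z ↦ ±z + λ ∈ 𝔽_l`, for `λ ∈ 𝔽_l`]" ([IUTchI] Def 6.1 (i), p. 155).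
[cite: Mochizuki2012, IUTchI Def 6.1 (i) p.155] -/
structure FlPMTorsor (T : Type*) where
  /-- the `𝔽_l^{⋊±}`-orbit of bijections `T ≃ 𝔽_l` -/
  charts : Set (T ≃ ZMod l)
  /-- the orbit is nonempty -/
  nonempty : charts.Nonempty
  /-- `charts` is the `𝔽_l^{⋊±}`-orbit of each of its members -/
  eq_orbit : ∀ e ∈ charts, charts = Set.range fun g : FlPM l => e.trans (FlPM.toPerm l g)

namespace FlPMTorsor

variable {l} {T : Type*} (S : FlPMTorsor l T)

variable (l) in
/-- The tautological `𝔽_l^±`-torsor structure on `𝔽_l` (the orbit of the identity), cf. [IUTchI]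
Example 6.3 (i) "let us think of `𝔽_l` as an `𝔽_l^±`-torsor [relative to the tautological
`𝔽_l^±`-torsor structure]". [cite: Mochizuki2012, IUTchI Ex 6.3 (i) p.160] -/
def tautological : FlPMTorsor l (ZMod l) where
  charts := Set.range fun g : FlPM l => FlPM.toPerm l g
  nonempty := ⟨FlPM.toPerm l 1, 1, rfl⟩
  eq_orbit := by
    rintro e ⟨g, rfl⟩
    ext σ
    constructor
    · rintro ⟨h, rfl⟩
      refine ⟨h * g⁻¹, ?_⟩
      ext z
      simp only [Equiv.trans_apply, FlPM.toPerm_apply, mul_smul, inv_smul_smul]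
    · rintro ⟨h, rfl⟩
      refine ⟨h * g, ?_⟩
      ext z
      simp only [Equiv.trans_apply, FlPM.toPerm_apply, mul_smul]

/-- Any two charts of an `𝔽_l^±`-torsor differ by an element of `𝔽_l^{⋊±}`.
[cite: Mochizuki2012, IUTchI Def 6.1 (i) p.155] -/
theorem exists_of_mem {e e' : T ≃ ZMod l} (he : e ∈ S.charts) (he' : e' ∈ S.charts) :
    ∃ g : FlPM l, e' = e.trans (FlPM.toPerm l g) := by
  rw [S.eq_orbit e he] at he'
  obtain ⟨g, rfl⟩ := he'
  exact ⟨g, rfl⟩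

/-- The orbit of charts of an `𝔽_l^±`-torsor is stable under `𝔽_l^{⋊±}`.
[cite: Mochizuki2012, IUTchI Def 6.1 (i) p.155] -/
theorem trans_toPerm_mem {e : T ≃ ZMod l} (he : e ∈ S.charts) (g : FlPM l) :
    e.trans (FlPM.toPerm l g) ∈ S.charts := by
  rw [S.eq_orbit e he]
  exact ⟨g, rfl⟩

/-- `Aut_+(T)`: "the abelian group of automorphisms of the underlying set of `𝔽_l` given by the
translations `𝔽_l ∋ z ↦ z + λ ∈ 𝔽_l`, for `λ ∈ 𝔽_l`, determines an abelian group `Aut_+(T)` of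
'positive automorphisms' of the underlying set of `T`" ([IUTchI] Def 6.1 (i), p. 155): the
permutations of `T` that read as a translation in every chart of the orbit (equivalently in one
chart, `mem_autPlus_iff_exists`). [cite: Mochizuki2012, IUTchI Def 6.1 (i) p.155] -/
def autPlus : Subgroup (Equiv.Perm T) where
  carrier := {σ | ∀ e ∈ S.charts, ∃ c : ZMod l, ∀ t, e (σ t) = e t + c}
  one_mem' e _ := ⟨0, fun t => by simp⟩
  mul_mem' {σ τ} hσ hτ e he := by
    obtain ⟨c, hc⟩ := hσ e he
    obtain ⟨d, hd⟩ := hτ e he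
    exact ⟨d + c, fun t => by simp [hc, hd, add_assoc]⟩
  inv_mem' {σ} hσ e he := by
    obtain ⟨c, hc⟩ := hσ e he
    refine ⟨-c, fun t => ?_⟩
    have h := hc (σ⁻¹ t)
    simp only [Equiv.Perm.coe_inv, Equiv.apply_symm_apply] at h
    simp only [Equiv.Perm.coe_inv]
    rw [h]
    abel

/-- `Aut_±(T)`: "the group of automorphisms of the underlying set of `T` determined [relative to the
`𝔽_l^±`-torsor structure on `T`] by the group of automorphisms of the underlying set of `𝔽_l` given
by `𝔽_l^{⋊±}`" ([IUTchI] Def 6.1 (i), p. 155). [cite: Mochizuki2012, IUTchI Def 6.1 (i) p.155] -/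
def autPM : Subgroup (Equiv.Perm T) where
  carrier := {σ | ∀ e ∈ S.charts, ∃ g : FlPM l, ∀ t, e (σ t) = g • e t}
  one_mem' e _ := ⟨1, fun t => by simp⟩
  mul_mem' {σ τ} hσ hτ e he := by
    obtain ⟨g, hg⟩ := hσ e he
    obtain ⟨h, hh⟩ := hτ e he
    exact ⟨g * h, fun t => by simp [hg, hh, mul_smul]⟩
  inv_mem' {σ} hσ e he := by
    obtain ⟨g, hg⟩ := hσ e he
    refine ⟨g⁻¹, fun t => ?_⟩
    have h := hg (σ⁻¹ t)
    simp only [Equiv.Perm.coe_inv, Equiv.apply_symm_apply] at h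
    simp only [Equiv.Perm.coe_inv]
    rw [h, inv_smul_smul]

/-- Membership in `Aut_+(T)`, unfolded. [cite: Mochizuki2012, IUTchI Def 6.1 (i) p.155] -/
theorem mem_autPlus_iff (σ : Equiv.Perm T) :
    σ ∈ S.autPlus ↔ ∀ e ∈ S.charts, ∃ c : ZMod l, ∀ t, e (σ t) = e t + c := Iff.rfl

/-- Membership in `Aut_±(T)`, unfolded. [cite: Mochizuki2012, IUTchI Def 6.1 (i) p.155] -/
theorem mem_autPM_iff (σ : Equiv.Perm T) :
    σ ∈ S.autPM ↔ ∀ e ∈ S.charts, ∃ g : FlPM l, ∀ t, e (σ t) = g • e t := Iff.rfl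

/-- `Aut_+(T) ⊆ Aut_±(T)` ([IUTchI] Def 6.1 (i), p. 155). [cite: Mochizuki2012, IUTchI Def 6.1 (i) p.155] -/
theorem autPlus_le_autPM : S.autPlus ≤ S.autPM := by
  intro σ hσ e he
  obtain ⟨c, hc⟩ := hσ e he
  exact ⟨FlPM.transl c, fun t => by rw [hc, FlPM.transl_smul]⟩

/-- Chart-independence of `Aut_+(T)`: a permutation that reads as a translation in ONE chart of the
orbit reads as a translation in every chart (conjugating a translation by `z ↦ ±z + μ` gives a
translation). [cite: Mochizuki2012, IUTchI Def 6.1 (i) p.155] -/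
theorem mem_autPlus_iff_exists (σ : Equiv.Perm T) :
    σ ∈ S.autPlus ↔ ∃ e ∈ S.charts, ∃ c : ZMod l, ∀ t, e (σ t) = e t + c := by
  refine ⟨fun h => ⟨_, S.nonempty.some_mem, h _ S.nonempty.some_mem⟩, ?_⟩
  rintro ⟨e, he, c, hc⟩ e' he'
  obtain ⟨g, rfl⟩ := S.exists_of_mem he he'
  refine ⟨g.right • c, fun t => ?_⟩
  simp only [Equiv.trans_apply, FlPM.toPerm_apply, hc]
  have h := FlPM.smul_inv_smul_add g c (g • e t)
  rwa [inv_smul_smul] at h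

/-- Chart-independence of `Aut_±(T)`. [cite: Mochizuki2012, IUTchI Def 6.1 (i) p.155] -/
theorem mem_autPM_iff_exists (σ : Equiv.Perm T) :
    σ ∈ S.autPM ↔ ∃ e ∈ S.charts, ∃ g : FlPM l, ∀ t, e (σ t) = g • e t := by
  refine ⟨fun h => ⟨_, S.nonempty.some_mem, h _ S.nonempty.some_mem⟩, ?_⟩
  rintro ⟨e, he, g, hg⟩ e' he'
  obtain ⟨h, rfl⟩ := S.exists_of_mem he he'
  refine ⟨h * g * h⁻¹, fun t => ?_⟩
  simp only [Equiv.trans_apply, FlPM.toPerm_apply, hg, mul_smul, inv_smul_smul]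

/-- `Aut_+(T)` is abelian ([IUTchI] Def 6.1 (i), p. 155: "an abelian group `Aut_+(T)`").
[cite: Mochizuki2012, IUTchI Def 6.1 (i) p.155] -/
theorem autPlus_comm {σ τ : Equiv.Perm T} (hσ : σ ∈ S.autPlus) (hτ : τ ∈ S.autPlus) :
    σ * τ = τ * σ := by
  obtain ⟨e, he⟩ := S.nonempty
  obtain ⟨c, hc⟩ := hσ e he
  obtain ⟨d, hd⟩ := hτ e he
  ext t
  apply e.injective
  simp only [Equiv.Perm.coe_mul, Function.comp_apply, hc, hd]
  abel

/-- The translation parameter of a positive automorphism in the chart `e`: `σ ↦ e(σ t) − e(t)`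
(independent of `t`). [cite: Mochizuki2012, IUTchI Def 6.1 (i) p.155] -/
noncomputable def shiftChart {e : T ≃ ZMod l} (he : e ∈ S.charts) (σ : S.autPlus) : ZMod l :=
  (σ.2 e he).choose

/-- Defining property of the translation parameter `shiftChart`.
[cite: Mochizuki2012, IUTchI Def 6.1 (i) p.155] -/
theorem shiftChart_spec {e : T ≃ ZMod l} (he : e ∈ S.charts) (σ : S.autPlus) (t : T) :
    e (σ.1 t) = e t + S.shiftChart he σ :=
  (σ.2 e he).choose_spec t

/-- "[such that the abelian group structure of `Aut_+(T)` coincides with the `𝔽_l`-module structure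
of `Aut_+(T)` induced by this `𝔽_l^±`-group structure]" ([IUTchI] Def 6.1 (i), p. 155): the chart
`Aut_+(T) → 𝔽_l` is a homomorphism. [cite: Mochizuki2012, IUTchI Def 6.1 (i) p.155] -/
theorem shiftChart_mul {e : T ≃ ZMod l} (he : e ∈ S.charts) (σ τ : S.autPlus) :
    S.shiftChart he (σ * τ) = S.shiftChart he σ + S.shiftChart he τ := by
  have h := S.shiftChart_spec he (σ * τ) (e.symm 0)
  rw [Subgroup.coe_mul, Equiv.Perm.coe_mul, Function.comp_apply, S.shiftChart_spec he σ,
    S.shiftChart_spec he τ, add_assoc, add_right_inj] at h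
  rw [← h, add_comm]

/-- The translation of `T` by `c ∈ 𝔽_l` read in the chart `e`, an element of `Aut_+(T)`.
[cite: Mochizuki2012, IUTchI Def 6.1 (i) p.155] -/
noncomputable def translChart {e : T ≃ ZMod l} (he : e ∈ S.charts) (c : ZMod l) : S.autPlus :=
  ⟨e.trans ((Equiv.addRight c).trans e.symm), (S.mem_autPlus_iff_exists _).mpr
    ⟨e, he, c, fun t => by simp⟩⟩

/-- The translation by `c` read in the chart `e` is `t ↦ e⁻¹(e(t) + c)`.
[cite: Mochizuki2012, IUTchI Def 6.1 (i) p.155] -/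
@[simp] theorem translChart_apply {e : T ≃ ZMod l} (he : e ∈ S.charts) (c : ZMod l) (t : T) :
    (S.translChart he c).1 t = e.symm (e t + c) := rfl

/-- The translation parameter of the translation by `c` is `c`.
[cite: Mochizuki2012, IUTchI Def 6.1 (i) p.155] -/
theorem shiftChart_translChart {e : T ≃ ZMod l} (he : e ∈ S.charts) (c : ZMod l) :
    S.shiftChart he (S.translChart he c) = c := by
  have h := S.shiftChart_spec he (S.translChart he c) (e.symm 0)
  rw [translChart_apply, Equiv.apply_symm_apply, Equiv.apply_symm_apply, zero_add, zero_add] at h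
  exact h.symm

/-- The chart `Aut_+(T) ≃ 𝔽_l`, `σ ↦` its translation parameter read in the chart `e` of `T`.
[cite: Mochizuki2012, IUTchI Def 6.1 (i) p.155] -/
noncomputable def shiftEquiv {e : T ≃ ZMod l} (he : e ∈ S.charts) : S.autPlus ≃ ZMod l where
  toFun := S.shiftChart he
  invFun := S.translChart he
  left_inv σ := by
    apply Subtype.ext
    ext t
    rw [translChart_apply, ← S.shiftChart_spec he σ t, Equiv.symm_apply_apply]
  right_inv c := S.shiftChart_translChart he c

/-- `shiftEquiv` is `shiftChart` as a function. [cite: Mochizuki2012, IUTchI Def 6.1 (i) p.155] -/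
@[simp] theorem shiftEquiv_apply {e : T ≃ ZMod l} (he : e ∈ S.charts) (σ : S.autPlus) :
    S.shiftEquiv he σ = S.shiftChart he σ := rfl

/-- Changing the chart of `T` by `(μ, ε) ∈ 𝔽_l^{⋊±}` multiplies translation parameters by `ε`.
[cite: Mochizuki2012, IUTchI Def 6.1 (i) p.155] -/
theorem shiftChart_trans {e : T ≃ ZMod l} (he : e ∈ S.charts) (g : FlPM l) (σ : S.autPlus) :
    S.shiftChart (S.trans_toPerm_mem he g) σ = g.right • S.shiftChart he σ := by
  have h := S.shiftChart_spec (S.trans_toPerm_mem he g) σ (e.symm 0)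
  simp only [Equiv.trans_apply, FlPM.toPerm_apply, S.shiftChart_spec he σ] at h
  have h' := FlPM.smul_inv_smul_add g (S.shiftChart he σ) (g • e (e.symm 0))
  rw [inv_smul_smul] at h'
  rw [h'] at h
  exact (add_left_cancel h).symm

/-- "Moreover, `Aut_+(T)` is equipped with a natural structure of `𝔽_l^±`-group" ([IUTchI] Def 6.1
(i), p. 155): the charts `Aut_+(T) ≃ 𝔽_l` obtained by reading translation parameters in the charts
of `T` form a `{±1}`-orbit. [cite: Mochizuki2012, IUTchI Def 6.1 (i) p.155] -/
noncomputable def autPlusPM : FlPMGroup l S.autPlus where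
  charts := {f | ∃ e, ∃ he : e ∈ S.charts, f = S.shiftEquiv he}
  nonempty := ⟨_, _, S.nonempty.some_mem, rfl⟩
  eq_orbit := by
    rintro f ⟨e, he, rfl⟩
    ext f'
    constructor
    · rintro ⟨e', he', rfl⟩
      obtain ⟨g, rfl⟩ := S.exists_of_mem he he'
      refine ⟨g.right, ?_⟩
      ext σ
      simp only [shiftEquiv_apply, Equiv.trans_apply, signPerm_apply]
      exact (S.shiftChart_trans he g σ).symm
    · rintro ⟨ε, rfl⟩
      refine ⟨_, S.trans_toPerm_mem he (FlPM.mk 0 ε), ?_⟩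
      ext σ
      simp only [shiftEquiv_apply, Equiv.trans_apply, signPerm_apply]
      exact (S.shiftChart_trans he (FlPM.mk 0 ε) σ).symm

/-- The reflection `t ↦ e⁻¹(−e(t))` of `T` read in a chart `e`.
[cite: Mochizuki2012, IUTchI Def 6.1 (i) p.155] -/
def reflection (e : T ≃ ZMod l) : Equiv.Perm T := e.trans ((signPerm l (-1)).trans e.symm)

/-- The reflection read in the chart `e` is `t ↦ e⁻¹(−e(t))`.
[cite: Mochizuki2012, IUTchI Def 6.1 (i) p.155] -/
@[simp] theorem reflection_apply (e : T ≃ ZMod l) (t : T) : reflection e t = e.symm (-e t) := by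
  simp [reflection]

/-- The reflection read in a chart of the orbit lies in `Aut_±(T)`.
[cite: Mochizuki2012, IUTchI Def 6.1 (i) p.155] -/
theorem reflection_mem_autPM {e : T ≃ ZMod l} (he : e ∈ S.charts) : reflection e ∈ S.autPM := by
  rw [S.mem_autPM_iff_exists]
  exact ⟨e, he, FlPM.mk 0 (-1), fun t => by simp⟩

/-- For `2 < l` the reflection is not a positive automorphism (`z ↦ −z` is not a translation).
[cite: Mochizuki2012, IUTchI Def 6.1 (i) p.155] -/
theorem reflection_not_mem_autPlus (hl : 2 < l) {e : T ≃ ZMod l} (he : e ∈ S.charts) :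
    reflection e ∉ S.autPlus := by
  intro h
  obtain ⟨c, hc⟩ := h e he
  have h0 := hc (e.symm 0)
  have h1 := hc (e.symm 1)
  simp only [reflection_apply, Equiv.apply_symm_apply, neg_zero, zero_add] at h0 h1
  rw [← h0, add_zero] at h1
  exact one_ne_neg_one' l hl h1.symm

/-- Every element of `Aut_±(T)` is positive, or its composite with the reflection is positive.
[cite: Mochizuki2012, IUTchI Def 6.1 (i) p.155] -/
theorem mem_autPM_cases {e : T ≃ ZMod l} (he : e ∈ S.charts) {σ : Equiv.Perm T}
    (hσ : σ ∈ S.autPM) : σ ∈ S.autPlus ∨ reflection e * σ ∈ S.autPlus := by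
  obtain ⟨g, hg⟩ := hσ e he
  rcases FlPM.isPositive_or_isNegative g with hpos | hneg
  · left
    rw [S.mem_autPlus_iff_exists]
    obtain ⟨c, rfl⟩ := (FlPM.isPositive_iff_exists_transl g).mp hpos
    exact ⟨e, he, c, fun t => by rw [hg, FlPM.transl_smul]⟩
  · right
    rw [S.mem_autPlus_iff_exists]
    refine ⟨e, he, -g.left.toAdd, fun t => ?_⟩
    rw [FlPM.IsNegative] at hneg
    simp only [Equiv.Perm.coe_mul, Function.comp_apply, reflection_apply, Equiv.apply_symm_apply, hg,
      FlPM.smul_def, hneg, neg_one_units_smul']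
    abel

/-- "`Aut_+(T) ⊆ Aut_±(T)` is [a] subgroup of index 2" ([IUTchI] Def 6.1 (i), p. 155), for `2 < l`.
[cite: Mochizuki2012, IUTchI Def 6.1 (i) p.155] -/
theorem relIndex_autPlus_autPM (hl : 2 < l) : S.autPlus.relIndex S.autPM = 2 := by
  obtain ⟨e, he⟩ := S.nonempty
  rw [Subgroup.relIndex, Subgroup.index_eq_two_iff_exists_notMem_and']
  refine ⟨⟨_, S.reflection_mem_autPM he⟩, ?_, fun σ => ?_⟩
  · rw [Subgroup.mem_subgroupOf]
    exact S.reflection_not_mem_autPlus hl he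
  · simp only [Subgroup.mem_subgroupOf, Subgroup.coe_mul]
    exact (S.mem_autPM_cases he σ.2).symm

/-- "[so `Aut_+(T) ⊆ Aut_±(T)` is the **unique** subgroup of index 2]" ([IUTchI] Def 6.1 (i), p. 155),
for odd `l > 2`: an index-2 subgroup contains all squares, hence (as `2` is invertible in `𝔽_l`)
all of `Aut_+(T)`, and then equals it by comparing indices.
[cite: Mochizuki2012, IUTchI Def 6.1 (i) p.155] -/
theorem eq_autPlus_of_relIndex_eq_two (hl : 2 < l) (hodd : Odd l) (H : Subgroup (Equiv.Perm T))
    (hH : H ≤ S.autPM) (h2 : H.relIndex S.autPM = 2) : H = S.autPlus := by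
  obtain ⟨e, he⟩ := S.nonempty
  -- squares of elements of `Aut_±(T)` lie in `H`
  have hsq : ∀ σ ∈ S.autPM, σ * σ ∈ H := by
    intro σ hσ
    have key := Subgroup.mul_self_mem_of_index_two h2 ⟨σ, hσ⟩
    simpa [Subgroup.mem_subgroupOf] using key
  -- hence every positive automorphism (a translation by `c` = square of that by `c/2`) lies in `H`
  have hplus : S.autPlus ≤ H := by
    intro σ hσ
    obtain ⟨c, hc⟩ := hσ e he
    have h2u : IsUnit (2 : ZMod l) := by
      rw [← Nat.cast_ofNat, ZMod.isUnit_iff_coprime]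
      exact Nat.coprime_two_left.mpr hodd
    obtain ⟨u, hu⟩ := h2u
    have hτ : (S.translChart he (↑u⁻¹ * c)).1 ∈ S.autPM := S.autPlus_le_autPM (S.translChart he _).2
    have hστ : σ = (S.translChart he (↑u⁻¹ * c)).1 * (S.translChart he (↑u⁻¹ * c)).1 := by
      ext t
      apply e.injective
      simp only [hc, Equiv.Perm.coe_mul, Function.comp_apply, translChart_apply,
        Equiv.apply_symm_apply, add_assoc, add_right_inj]
      rw [← two_mul, ← mul_assoc, ← hu, Units.mul_inv, one_mul]
    rw [hστ]
    exact hsq _ hτ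
  -- both `H` and `Aut_+(T)` have index `2` in `Aut_±(T)`
  have hmul := Subgroup.relIndex_mul_relIndex S.autPlus H S.autPM hplus hH
  rw [h2, S.relIndex_autPlus_autPM hl] at hmul
  have h1 : S.autPlus.relIndex H = 1 := by omega
  exact le_antisymm (Subgroup.relIndex_eq_one.mp h1) hplus

end FlPMTorsor

end Literature.IUT.HodgeTheaters
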